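import Summits.AnomalousDissipation.AnomalousDissipation.Theses.MomentParity
import Summits.AnomalousDissipation.AnomalousDissipation.Theorems.MomentParityLadderGlue

/-!
# Line `clause-split` — crux `MomentParity.MomentLadder` (stmt-AnomalousDissipation-11463)
# REDIRECT line registered by the crux strategist r1 (2026-08-17). It does not replace `Lines/Sketch.lean` (dead) or
# `Lines/planar_corner.lean` (ALT, vetted PASS); it RECORDS, in the crux's own skeleton registry, the route's clause
# decomposition of the summit-sufficient crux into its two EXISTING binder cruxes, with the LANDED assembly.

Why this file exists. `MomentLadder → AnomalousDissipation` is a tree theorem (`anomalousDissipation_of_MomentLadder`,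
p114976), so the crux is summit-SUFFICIENT and no line can close it short of a zeroth-law construction for SOME steady
force (census s1/b1/r1). By the human ruling RESTATED IS A REDIRECT (2026-08-16) such a crux is honest exactly through
its own decomposition one level down: (a) k = 2 load-bearing pieces, (b) assembly PROVED, (c) no piece gives S or X on
its own, (d) a plan per open piece. The decomposition is the route's clause split
`MomentLadder ⇐ GalerkinInvariantLoud (stmt-14283) ∧ ResolvedDissipation (stmt-14284)` whose glue is LANDED
(`Theorems.ladderGlue_proof : LadderGlue`, item stmt-14285, proved) and whose pieces are the two open binders of the
route's deciding theorem `closes` (which DERIVES `MomentLadder` on its first line). It was never registered as the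
crux's split (`route edit --split` is reserved to a final cycle and bounced for the s1, b1 and r1 strategist seats), so the ledger's
`restated` record read "assembly not proved" over the 21 loose stubs of earlier lines. This skeleton makes the
decomposition machine-visible on the item: two stubs = the two pieces BY NAME, composition = the landed glue.

Stubs (the ONLY sorries; each is an existing, separately staffed crux item — claim THOSE, not 11463):
* `stub_galerkinInvariantLoud` := `GalerkinInvariantLoud` (stmt-14283; open, XL; skeleton sha 9a238a63…, 3 stubs;
  currently parked `blocked-on: stmt-2986` = MirrorVariety.GalerkinSteadyZerothLaw → GIL landed, p163814).
* `stub_resolvedDissipation` := `ResolvedDissipation` (stmt-14284; open, L; skeleton sha 8fe8a5dc…, 2 stubs;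
  currently `blocked-on: stmt-14265` = Correlation.NoMeanLeakage → RD landed, p159669/p160579; also
  LHEE → RD landed, `resolvedDissipation_of_lerayHopfEnergyEquality`).
Certificate (planner folder `bc/`, attached as evidence; see `BC2-REDIRECT-r1.md`): piece probes `→ S` / `→ X` FAIL 8/8
(minimal imports) and 10/10 (126 landed Theorems modules, `exact?`); records: `X → GIL` SUCCEEDS (landed p96409 — GIL is a
consequence of X used toward X), `S → GIL`, `S → RD`, `X → RD` fail; no `summit_equivalent` flag and no landed iff on
either piece; `trivial_seam` (pure logic) acknowledged.
-/

set_option linter.dupNamespace false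

namespace Summit.AnomalousDissipation.AnomalousDissipation.Cruxes.MomentLadder.ClauseSplit

open Summit.AnomalousDissipation.AnomalousDissipation.Theses.MomentParity

/-! ## Registered stubs (= the two pieces, by name) -/

/-- STUB 1 = piece (A): the sibling crux `GalerkinInvariantLoud` (stmt-AnomalousDissipation-14283) — loud bounded
Galerkin-INVARIANT ensembles at frequently many levels along `ν_j → 0` for SOME smooth steady force (the converged-DNS
zeroth law in WORK form: `ν⟨‖∇u‖²⟩ = (f, ū)`). OPEN, XL; implied by X (p96409), not known to imply X or S. -/
theorem stub_galerkinInvariantLoud : GalerkinInvariantLoud := by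
  sorry

/-- STUB 2 = piece (B): the sibling crux `ResolvedDissipation` (stmt-AnomalousDissipation-14284) — at FIXED `ν`, one
resolution schedule `κ(f, ν, R)` for the mean enstrophy of every bounded Galerkin-stationary level-`N` law, uniformly in
`N` (⟺ mean energy EQUALITY of Galerkin-limit stationary statistical solutions, `resolvedDissipation_iff_galerkinLimitEnergyEq`;
implied by the Leray–Hopf energy equality, `resolvedDissipation_of_lerayHopfEnergyEquality`). OPEN, L; `ν → 0`-free. -/
theorem stub_resolvedDissipation : ResolvedDissipation := by
  sorry

/-! ## Composition (kernel-checked; the landed glue, nothing else) -/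

/-- The assembly of the split in arrow form — it IS the landed theorem `Theorems.ladderGlue_proof` (stmt-14285, proved). -/
theorem MomentLadder_of : GalerkinInvariantLoud → ResolvedDissipation → MomentLadder :=
  Theorems.ladderGlue_proof

/-- The skeleton closes the crux BY NAME modulo its two registered stubs. -/
theorem momentLadder_of_stubs : MomentLadder :=
  MomentLadder_of stub_galerkinInvariantLoud stub_resolvedDissipation

end Summit.AnomalousDissipation.AnomalousDissipation.Cruxes.MomentLadder.ClauseSplit
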